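import Mathlib
import HarnessLib
import Summits.HubbardSuperconductivity.HubbardSuperconductivity.Theorems.KLProgrammeKLRegimeVolumeLimitSingleSiteMatsubaraDecay
import Summits.HubbardSuperconductivity.HubbardSuperconductivity.Theorems.KLProgrammeKLRegimeVolumeLimitNestedPoisson

/-!
# The dressed site modes of `T′`, the radial lattice sum, and the Bloch-sum expansion of the dressed two-time function
# `𝒵′(k,p) = ∫₀^β e^{ikτ}⟨T′_{−p}(τ)T′_{−p}†⟩` with volume-uniform per-pair decay — for EVERY coupling
# (seat hubbard-kl-k3c5-p3 g6, technique «OS-positivity-free direct assembly»; VL child of K3, `--supports` stmt-…-19921)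

Route `KLProgramme`, crux K3, child VOLUME-LIMIT.  Third file of «the one-volume momentum modulus (M) of the VL carrier is SOFT»
(after `…VolumeLimitMatsubaraResolvent`, `…VolumeLimitSingleSiteMatsubaraDecay`).  `H = hubbardTorusWith 2 L 1 U μ`, `β > 0`:

* §4 the half-shifted dressed site mode `A_z = c_{z↑}n_{z↓} − ½c_{z↑}` (generic site type): single-site (`A_z, A_z† ∈ 𝔄_{z}`), odd, `‖A_z‖ ≤ 3/2`,
  and `{A_z, A_w†} = 0` for `z ≠ w`;
* §5 `Σ_i |cRepZ((x−y)_i)| ≤ d·dist(x,y)` and the radial lattice sum `Σ_x dist(x,y)·e^{−γ dist(x,y)} ≤ Σ'_r 4(2r+1)·r·e^{−γr}` on `(ℤ/Lℤ)²`,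
  uniformly in `L` (tree: `sum_radial_le`, `card_filter_torusDist_eq_le`);
* §6 k3c5-p1's half-shifted dressed mode is a Bloch sum of the `A_z`: `T′_{−p} = Σ_z L⁻¹χ_p(z̄)·A_z` (`shiftedDressed_eq_sum`), hence
  `𝒵′(k,p) = Σ_{x,y} L⁻²χ_p(x)conj χ_p(y)·h(x,y)` with MOMENTUM-INDEPENDENT `h(x,y) = ∫₀^β e^{ikτ}⟨A_{x̂}(τ)A_{ŷ}†⟩` and the per-pair decay
  `‖h(x,y)‖ ≤ (9/4)(5β/π)e^{−γ dist(x,y)}` (`x ≠ y`; `norm_matsubara_singleSite_le`);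

Next file (`…VolumeLimitModulus`): the momentum modulus `‖𝒵′(k,p₁) − 𝒵′(k,p₂)‖ ≤ C(β,U,μ)·Σ_i|Δp_i|_𝕋` uniformly in `L` and `k`, then
`Six∞_L(n,p) = −𝒵′(k₀(n),p)` (k3c5-p1), `Σ∞⁰ = U·occ∞ + U²·Six∞`, cutoff removal ⇒ the `hM` text of `carrierRateText_of_nested` for EVERY bundle and
window.  Everything is proved; no definition.
-/

noncomputable section

namespace Summit.HubbardSuperconductivity.HubbardSuperconductivity.Theorems.ThermalGreen

set_option linter.dupNamespace false -- summit = problem name (single-conjunct summit), D-0017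

open scoped Matrix.Norms.L2Operator ComplexConjugate
open Matrix Complex MeasureTheory intervalIntegral Finset Literature.MathematicalPhysics.QuantumLattice Literature.Probability.LatticeModels

/-! ## §4 The half-shifted dressed site mode `A_z = c_{z↑} n_{z↓} − ½ c_{z↑}` (generic site type) -/

section Dressed

variable {Λ : Type*} [LinearOrder Λ] [Fintype Λ]

/-- `A_z ∈ 𝔄_{z}`. -/
theorem dressedMode_mem (z : Λ) :
    annihilation (orb z 0) * numberOp z 1 - (1 / 2 : ℂ) • annihilation (orb z 0) ∈
      carSubalgebra (orbSet ({z} : Finset Λ)) := by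
  have hc : annihilation (orb z 0) ∈ carSubalgebra (orbSet ({z} : Finset Λ)) :=
    annihilation_mem_carSubalgebra (orb_mem_orbSet (Finset.mem_singleton_self z) 0)
  have hn : numberOp z 1 ∈ carSubalgebra (orbSet ({z} : Finset Λ)) := by
    rw [numberOp]
    exact Subalgebra.mul_mem _ (creation_mem_carSubalgebra (orb_mem_orbSet (Finset.mem_singleton_self z) 1))
      (annihilation_mem_carSubalgebra (orb_mem_orbSet (Finset.mem_singleton_self z) 1))
  exact Subalgebra.sub_mem _ (Subalgebra.mul_mem _ hc hn) (Subalgebra.smul_mem _ hc _)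

/-- `A_z† = n_{z↓} c†_{z↑} − ½ c†_{z↑}`. -/
theorem dressedMode_conjTranspose (z : Λ) :
    (annihilation (orb z 0) * numberOp z 1 - (1 / 2 : ℂ) • annihilation (orb z 0))ᴴ =
      numberOp z 1 * creation (orb z 0) - (1 / 2 : ℂ) • creation (orb z 0) := by
  simp only [conjTranspose_sub, conjTranspose_smul, conjTranspose_mul, numberOp, annihilation_conjTranspose,
    creation_conjTranspose, Matrix.mul_assoc]
  congr 1
  have h : star (1 / 2 : ℂ) = 1 / 2 := by simp
  rw [h]

/-- `A_z† ∈ 𝔄_{z}`. -/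
theorem dressedMode_conjTranspose_mem (z : Λ) :
    (annihilation (orb z 0) * numberOp z 1 - (1 / 2 : ℂ) • annihilation (orb z 0))ᴴ ∈
      carSubalgebra (orbSet ({z} : Finset Λ)) := by
  rw [dressedMode_conjTranspose]
  have hc : creation (orb z 0) ∈ carSubalgebra (orbSet ({z} : Finset Λ)) :=
    creation_mem_carSubalgebra (orb_mem_orbSet (Finset.mem_singleton_self z) 0)
  have hn : numberOp z 1 ∈ carSubalgebra (orbSet ({z} : Finset Λ)) := by
    rw [numberOp]
    exact Subalgebra.mul_mem _ (creation_mem_carSubalgebra (orb_mem_orbSet (Finset.mem_singleton_self z) 1))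
      (annihilation_mem_carSubalgebra (orb_mem_orbSet (Finset.mem_singleton_self z) 1))
  exact Subalgebra.sub_mem _ (Subalgebra.mul_mem _ hn hc) (Subalgebra.smul_mem _ hc _)

/-- The number operator is even: `(-1)^N n_{zσ} = n_{zσ} (-1)^N`. -/
theorem parityOp_mul_numberOp (z : Λ) (σ : Fin 2) :
    parityOp * numberOp z σ = numberOp z σ * parityOp := by
  rw [numberOp, ← Matrix.mul_assoc, parityOp_mul_creation, Matrix.neg_mul, Matrix.mul_assoc,
    parityOp_mul_annihilation_holds, Matrix.mul_neg, neg_neg, Matrix.mul_assoc]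

/-- `A_z` is odd. -/
theorem parityOp_mul_dressedMode (z : Λ) :
    parityOp * (annihilation (orb z 0) * numberOp z 1 - (1 / 2 : ℂ) • annihilation (orb z 0)) =
      -((annihilation (orb z 0) * numberOp z 1 - (1 / 2 : ℂ) • annihilation (orb z 0)) * parityOp) := by
  rw [Matrix.mul_sub, Matrix.mul_smul, ← Matrix.mul_assoc, parityOp_mul_annihilation_holds, Matrix.neg_mul, Matrix.mul_assoc,
    parityOp_mul_numberOp, Matrix.sub_mul, Matrix.smul_mul, Matrix.mul_assoc, smul_neg, neg_sub_neg, neg_sub']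
  abel

/-- `A_z†` is odd. -/
theorem parityOp_mul_dressedMode_conjTranspose (z : Λ) :
    parityOp * (annihilation (orb z 0) * numberOp z 1 - (1 / 2 : ℂ) • annihilation (orb z 0))ᴴ =
      -((annihilation (orb z 0) * numberOp z 1 - (1 / 2 : ℂ) • annihilation (orb z 0))ᴴ * parityOp) := by
  rw [dressedMode_conjTranspose, Matrix.mul_sub, Matrix.mul_smul, ← Matrix.mul_assoc, parityOp_mul_numberOp, Matrix.mul_assoc,
    parityOp_mul_creation, Matrix.mul_neg, Matrix.sub_mul, Matrix.smul_mul, Matrix.mul_assoc, smul_neg]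
  abel

/-- `‖A_z‖ ≤ 3/2`. -/
theorem norm_dressedMode_le (z : Λ) :
    ‖annihilation (orb z 0) * numberOp z 1 - (1 / 2 : ℂ) • annihilation (orb z 0)‖ ≤ 3 / 2 := by
  have h1 : ‖annihilation (orb z 0) * numberOp z 1‖ ≤ 1 :=
    (norm_mul_le _ _).trans (mul_le_one₀ (norm_annihilation_le_one _) (norm_nonneg _) (norm_numberOp_le_one z 1))
  have h2 : ‖(1 / 2 : ℂ) • annihilation (orb z 0)‖ ≤ 1 / 2 := by
    rw [norm_smul]
    have : ‖(1 / 2 : ℂ)‖ = 1 / 2 := by simp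
    rw [this]
    have := norm_annihilation_le_one (orb z 0)
    linarith
  exact (norm_sub_le _ _).trans (by linarith)

/-- `‖A_z†‖ ≤ 3/2`. -/
theorem norm_dressedMode_conjTranspose_le (z : Λ) :
    ‖(annihilation (orb z 0) * numberOp z 1 - (1 / 2 : ℂ) • annihilation (orb z 0))ᴴ‖ ≤ 3 / 2 := by
  rw [Matrix.l2_opNorm_conjTranspose]
  exact norm_dressedMode_le z

/-- `c_{z↑}` commutes with `n_{w↓}` (different orbitals). -/
theorem annihilation_up_commute_numberOp_down (z w : Λ) :
    Commute (annihilation (orb z 0) : Matrix (Finset (Orb Λ)) (Finset (Orb Λ)) ℂ) (numberOp w 1) := by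
  have hne : orb w 1 ≠ orb z 0 := fun h => absurd (orb_eq_orb_iff.1 h).2 (by decide)
  have h1 := congrArg conjTranspose (number_mul_creation_of_ne (ι := Orb Λ) hne)
  simp only [conjTranspose_mul, creation_conjTranspose, annihilation_conjTranspose] at h1
  -- h1 : annihilation (orb z 0) * (creation (orb w 1) * annihilation (orb w 1)) = … (up to association)
  rw [numberOp]
  show annihilation (orb z 0) * (creation (orb w 1) * annihilation (orb w 1)) =
    creation (orb w 1) * annihilation (orb w 1) * annihilation (orb z 0)
  simpa [Matrix.mul_assoc] using h1

/-- `n_{z↓}` commutes with `c†_{w↑}` (different orbitals). -/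
theorem numberOp_down_commute_creation_up (z w : Λ) :
    Commute (numberOp z 1 : Matrix (Finset (Orb Λ)) (Finset (Orb Λ)) ℂ) (creation (orb w 0)) := by
  have hne : orb z 1 ≠ orb w 0 := fun h => absurd (orb_eq_orb_iff.1 h).2 (by decide)
  rw [numberOp]
  exact number_mul_creation_of_ne hne

/-- **`{A_z, A_w†} = 0` for `z ≠ w`** (`A_z = c_{z↑}(n_{z↓} − ½)`, `A_w† = (n_{w↓} − ½)c†_{w↑}`; the brackets are even and commute with
everything in sight, and `{c_{z↑}, c†_{w↑}} = 0`). -/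
theorem dressedMode_anticomm_conjTranspose_eq_zero {z w : Λ} (hzw : z ≠ w) :
    (annihilation (orb z 0) * numberOp z 1 - (1 / 2 : ℂ) • annihilation (orb z 0)) *
          (annihilation (orb w 0) * numberOp w 1 - (1 / 2 : ℂ) • annihilation (orb w 0))ᴴ +
        (annihilation (orb w 0) * numberOp w 1 - (1 / 2 : ℂ) • annihilation (orb w 0))ᴴ *
          (annihilation (orb z 0) * numberOp z 1 - (1 / 2 : ℂ) • annihilation (orb z 0)) = 0 := by
  rw [dressedMode_conjTranspose]
  set c : Matrix (Finset (Orb Λ)) (Finset (Orb Λ)) ℂ := annihilation (orb z 0) with hc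
  set cd : Matrix (Finset (Orb Λ)) (Finset (Orb Λ)) ℂ := creation (orb w 0) with hcd
  set nz : Matrix (Finset (Orb Λ)) (Finset (Orb Λ)) ℂ := numberOp z 1 with hnz
  set nw : Matrix (Finset (Orb Λ)) (Finset (Orb Λ)) ℂ := numberOp w 1 with hnw
  set Mz : Matrix (Finset (Orb Λ)) (Finset (Orb Λ)) ℂ := nz - (1 / 2 : ℂ) • (1 : Matrix (Finset (Orb Λ)) (Finset (Orb Λ)) ℂ) with hMz
  set Mw : Matrix (Finset (Orb Λ)) (Finset (Orb Λ)) ℂ := nw - (1 / 2 : ℂ) • (1 : Matrix (Finset (Orb Λ)) (Finset (Orb Λ)) ℂ) with hMw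
  have hA : c * nz - (1 / 2 : ℂ) • c = c * Mz := by rw [hMz, Matrix.mul_sub, Matrix.mul_smul, Matrix.mul_one]
  have hB : nw * cd - (1 / 2 : ℂ) • cd = Mw * cd := by rw [hMw, Matrix.sub_mul, Matrix.smul_mul, Matrix.one_mul]
  rw [hA, hB]
  -- commutations
  have hcnz : Commute c nz := annihilation_up_commute_numberOp_down z z
  have hcnw : Commute c nw := annihilation_up_commute_numberOp_down z w
  have hnzcd : Commute nz cd := numberOp_down_commute_creation_up z w
  have hnznw : Commute nz nw := by
    rw [hnz, hnw, numberOp, numberOp]; exact numberAt_commute (orb z 1) (orb w 1)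
  have hcMz : Commute c Mz := hcnz.sub_right ((Commute.one_right c).smul_right _)
  have hcMw : Commute c Mw := hcnw.sub_right ((Commute.one_right c).smul_right _)
  have hMzcd : Commute Mz cd := hnzcd.sub_left ((Commute.one_left cd).smul_left _)
  have hMzMw : Commute Mz Mw :=
    (hnznw.sub_right ((Commute.one_right nz).smul_right _)).sub_left
      (((Commute.one_left nw).smul_left _).sub_right (((Commute.one_right _).smul_right _).smul_left _))
  -- the CAR `{c_{z↑}, c†_{w↑}} = 0`
  have hCAR : c * cd + cd * c = 0 := by
    have hne : orb z 0 ≠ orb w 0 := fun h => hzw (orb_eq_orb_iff.1 h).1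
    have h := annihilation_mul_creation_add_creation_mul_annihilation_holds (ι := Orb Λ) (orb z 0) (orb w 0)
    rw [if_neg hne] at h
    exact h
  have e1 : c * Mz * (Mw * cd) = Mz * Mw * (c * cd) := by
    calc c * Mz * (Mw * cd) = Mz * c * (Mw * cd) := by rw [hcMz.eq]
      _ = Mz * (c * Mw) * cd := by simp only [Matrix.mul_assoc]
      _ = Mz * (Mw * c) * cd := by rw [hcMw.eq]
      _ = Mz * Mw * (c * cd) := by simp only [Matrix.mul_assoc]
  have e2 : Mw * cd * (c * Mz) = Mz * Mw * (cd * c) := by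
    calc Mw * cd * (c * Mz) = Mw * cd * (Mz * c) := by rw [hcMz.eq]
      _ = Mw * (cd * Mz) * c := by simp only [Matrix.mul_assoc]
      _ = Mw * (Mz * cd) * c := by rw [hMzcd.eq]
      _ = Mw * Mz * (cd * c) := by simp only [Matrix.mul_assoc]
      _ = Mz * Mw * (cd * c) := by rw [hMzMw.eq]
  rw [e1, e2, ← Matrix.mul_add, hCAR, Matrix.mul_zero]

end Dressed

/-! ## §5 The radial lattice sum on the torus -/

section Lattice

variable {L : ℕ} [NeZero L]

/-- `|cRepZ(y i)| ≤ ‖y‖_𝕋` (every centred coordinate is bounded by the torus norm). -/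
theorem natAbs_cRepZ_le_torusNorm {d : ℕ} (y : TorusSite d L) (i : Fin d) : (Torus.cRepZ (y i)).natAbs ≤ torusNorm y := by
  have h1 : (Torus.cRepZ (y i)).natAbs ≤ (y i).val := by
    have := Torus.natAbs_cRepZ_le (a := y i) (z := ((y i).val : ℤ)) (by rw [Int.cast_natCast, ZMod.natCast_zmod_val])
    rwa [Int.natAbs_natCast] at this
  have h2 : (Torus.cRepZ (y i)).natAbs ≤ L - (y i).val := by
    have hv : (y i).val ≤ L := (ZMod.val_lt (y i)).le
    have hcast : ((((y i).val : ℤ) - (L : ℤ) : ℤ) : ZMod L) = y i := by simp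
    have := Torus.natAbs_cRepZ_le (a := y i) hcast
    have hn : (((y i).val : ℤ) - (L : ℤ)).natAbs = L - (y i).val := by omega
    rwa [hn] at this
  have h3 : min (y i).val (L - (y i).val) ≤ torusNorm y :=
    Finset.le_sup (f := fun j : Fin d => min (y j).val (L - (y j).val)) (Finset.mem_univ i)
  exact (le_min h1 h2).trans h3

/-- `Σ_i |cRepZ((x − y) i)| ≤ d · dist(x, y)` on `(ℤ/Lℤ)^d`. -/
theorem sum_abs_cRepZ_sub_le {d : ℕ} (x y : TorusSite d L) :
    ∑ i, |(Torus.cRepZ ((x - y) i) : ℝ)| ≤ d * (torusDist x y : ℝ) := by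
  have h : ∀ i, |(Torus.cRepZ ((x - y) i) : ℝ)| ≤ (torusDist x y : ℝ) := by
    intro i
    rw [← Int.cast_abs, Int.abs_eq_natAbs, Int.cast_natCast]
    exact_mod_cast natAbs_cRepZ_le_torusNorm (x - y) i
  calc ∑ i, |(Torus.cRepZ ((x - y) i) : ℝ)| ≤ ∑ _i : Fin d, (torusDist x y : ℝ) := Finset.sum_le_sum fun i _ => h i
    _ = d * (torusDist x y : ℝ) := by rw [Finset.sum_const, Finset.card_univ, Fintype.card_fin, nsmul_eq_mul]

/-- **The radial sum with a first moment is bounded uniformly in the volume**: for `γ > 0` and every `y`,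
`Σ_{x ∈ (ℤ/Lℤ)²} dist(x,y)·e^{−γ·dist(x,y)} ≤ Σ'_{r} 4(2r+1)·r·e^{−γr}` (sphere count `≤ 4(2r+1)`, `sum_radial_le`). -/
theorem sum_torusDist_mul_exp_le {γ : ℝ} (hγ : 0 < γ) (y : TorusSite 2 L) :
    ∑ x : TorusSite 2 L, (torusDist x y : ℝ) * Real.exp (-(γ * torusDist x y)) ≤
      ∑' r : ℕ, (4 * (2 * (r : ℝ) + 1)) * ((r : ℝ) * Real.exp (-(γ * r))) := by
  have hF0 : ∀ r : ℕ, 0 ≤ (r : ℝ) * Real.exp (-(γ * r)) := fun r => by positivity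
  have h := sum_radial_le (d := 2) (fun r : ℕ => (r : ℝ) * Real.exp (-(γ * r))) hF0 y
    (card_filter_torusDist_eq_le (by norm_num) y) (fun u => torusDist_lt u y)
  refine h.trans ?_
  have hsumm : Summable (fun r : ℕ => (4 * (2 * (r : ℝ) + 1)) * ((r : ℝ) * Real.exp (-(γ * r)))) := by
    have h2 := (Real.summable_pow_mul_exp_neg_nat_mul 2 hγ).mul_left 8
    have h1 := (Real.summable_pow_mul_exp_neg_nat_mul 1 hγ).mul_left 4
    refine (h2.add h1).congr fun r => ?_
    rw [neg_mul]; ring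
  have hcast : ∀ r : ℕ, ((2 * (2 * (2 * r + 1) ^ (2 - 1)) : ℕ) : ℝ) = 4 * (2 * (r : ℝ) + 1) := by
    intro r; push_cast; ring
  calc ∑ r ∈ Finset.range L, ((2 * (2 * (2 * r + 1) ^ (2 - 1)) : ℕ) : ℝ) * ((r : ℝ) * Real.exp (-(γ * r)))
      = ∑ r ∈ Finset.range L, (4 * (2 * (r : ℝ) + 1)) * ((r : ℝ) * Real.exp (-(γ * r))) :=
        Finset.sum_congr rfl fun r _ => by rw [hcast]
    _ ≤ ∑' r : ℕ, (4 * (2 * (r : ℝ) + 1)) * ((r : ℝ) * Real.exp (-(γ * r))) :=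
        hsumm.sum_le_tsum _ fun r _ => by positivity

end Lattice

/-! ## §6 The dressed two-time Matsubara function `𝒵′(k,p)` and its momentum modulus -/

section DressedTorus

variable {L : ℕ} [NeZero L]

open Summit.HubbardSuperconductivity.HubbardSuperconductivity.Theorems.KLProgrammeLegKernels

/-- `conj χ_{−p}(x) = χ_p(x)`. -/
theorem conj_torusChar_neg_left (p x : TorusSite 2 L) : conj (torusChar (-p) x) = torusChar p x := by
  rw [torusChar_comm, torusChar_neg_right, torusChar_comm, starRingEnd_self_apply]

/-- **`T′_{−p} = Σ_z L⁻¹χ_p(z̄)·A_z`**: k3c5-p1's half-shifted dressed mode `(Σ_z L⁻¹χ_{−p}(z̄) n_{z↓}c†_{z↑})ᴴ − ½c_{−p↑}` is the Bloch sum of the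
single-site modes `A_z = c_{z↑}n_{z↓} − ½c_{z↑}`. -/
theorem shiftedDressed_eq_sum [DecidableEq (FermionTorus 2 L)] (p : TorusSite 2 L) :
    (∑ z : FermionTorus 2 L, (torusFourierWeight 2 L * torusChar (-p) z.toTorusSite) • (numberOp z 1 * creation (orb z 0)))ᴴ -
        (1 / 2 : ℂ) • momentumAnnihilation (-p) 0 =
      ∑ z : FermionTorus 2 L, (torusFourierWeight 2 L * torusChar p z.toTorusSite) •
        (annihilation (orb z 0) * numberOp z 1 - (1 / 2 : ℂ) • annihilation (orb z 0)) := by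
  have hstar : ∀ z : FermionTorus 2 L, star (torusFourierWeight 2 L * torusChar (-p) z.toTorusSite) =
      torusFourierWeight 2 L * torusChar p z.toTorusSite := by
    intro z
    rw [star_mul', star_torusFourierWeight, Complex.star_def, conj_torusChar_neg_left]
  have h1 : (∑ z : FermionTorus 2 L, (torusFourierWeight 2 L * torusChar (-p) z.toTorusSite) • (numberOp z 1 * creation (orb z 0)))ᴴ =
      ∑ z : FermionTorus 2 L, (torusFourierWeight 2 L * torusChar p z.toTorusSite) • (annihilation (orb z 0) * numberOp z 1) := by
    rw [Matrix.conjTranspose_sum]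
    refine Finset.sum_congr rfl fun z _ => ?_
    rw [Matrix.conjTranspose_smul, hstar, Matrix.conjTranspose_mul, numberOp, Matrix.conjTranspose_mul, creation_conjTranspose,
      annihilation_conjTranspose, creation_conjTranspose]
  have h2 : momentumAnnihilation (-p) 0 =
      ∑ z : FermionTorus 2 L, (torusFourierWeight 2 L * torusChar p z.toTorusSite) • annihilation (orb z 0) := by
    rw [momentumAnnihilation]
    refine Finset.sum_congr rfl fun z _ => ?_
    rw [conj_torusChar_neg_left]
  rw [h1, h2, Finset.smul_sum, ← Finset.sum_sub_distrib]
  refine Finset.sum_congr rfl fun z _ => ?_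
  rw [smul_sub, smul_comm]

/-- The adjoint: `T′_{−p}† = Σ_w L⁻¹ conj χ_p(w̄)·A_w†`. -/
theorem shiftedDressed_conjTranspose_eq_sum [DecidableEq (FermionTorus 2 L)] (p : TorusSite 2 L) :
    ((∑ z : FermionTorus 2 L, (torusFourierWeight 2 L * torusChar (-p) z.toTorusSite) • (numberOp z 1 * creation (orb z 0)))ᴴ -
        (1 / 2 : ℂ) • momentumAnnihilation (-p) 0)ᴴ =
      ∑ w : FermionTorus 2 L, (torusFourierWeight 2 L * conj (torusChar p w.toTorusSite)) •
        (annihilation (orb w 0) * numberOp w 1 - (1 / 2 : ℂ) • annihilation (orb w 0))ᴴ := by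
  rw [shiftedDressed_eq_sum, Matrix.conjTranspose_sum]
  refine Finset.sum_congr rfl fun w _ => ?_
  rw [Matrix.conjTranspose_smul, star_mul', star_torusFourierWeight, Complex.star_def]

/-- **`𝒵′(k,p) = Σ_x Σ_y L⁻¹χ_p(x)·L⁻¹conj χ_p(y)·h(x,y)`**, `h(x,y) = ∫₀^β e^{ikτ}⟨A_{x̂}(τ)A_{ŷ}†⟩` (the single-site Matsubara functions
do not depend on the momentum). -/
theorem shiftedDressedMatsubara_eq_sum [DecidableEq (FermionTorus 2 L)] (U μ β k : ℝ) (p : TorusSite 2 L) :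
    ∫ τ in (0 : ℝ)..β, cexp (I * k * τ) * gibbsState β (hubbardTorusWith 2 L 1 U μ)
        (imagTimeEvolve (hubbardTorusWith 2 L 1 U μ) (τ : ℂ)
          ((∑ z : FermionTorus 2 L, (torusFourierWeight 2 L * torusChar (-p) z.toTorusSite) • (numberOp z 1 * creation (orb z 0)))ᴴ -
            (1 / 2 : ℂ) • momentumAnnihilation (-p) 0) *
          ((∑ z : FermionTorus 2 L, (torusFourierWeight 2 L * torusChar (-p) z.toTorusSite) • (numberOp z 1 * creation (orb z 0)))ᴴ -
            (1 / 2 : ℂ) • momentumAnnihilation (-p) 0)ᴴ) =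
      ∑ x : TorusSite 2 L, ∑ y : TorusSite 2 L, (torusFourierWeight 2 L * torusChar p x) *
        ((torusFourierWeight 2 L * conj (torusChar p y)) *
          ∫ τ in (0 : ℝ)..β, cexp (I * k * τ) * gibbsState β (hubbardTorusWith 2 L 1 U μ)
            (imagTimeEvolve (hubbardTorusWith 2 L 1 U μ) (τ : ℂ)
              (annihilation (orb (FermionTorus.ofTorusSite x) 0) * numberOp (FermionTorus.ofTorusSite x) 1 -
                (1 / 2 : ℂ) • annihilation (orb (FermionTorus.ofTorusSite x) 0)) *
              (annihilation (orb (FermionTorus.ofTorusSite y) 0) * numberOp (FermionTorus.ofTorusSite y) 1 -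
                (1 / 2 : ℂ) • annihilation (orb (FermionTorus.ofTorusSite y) 0))ᴴ)) := by
  rw [shiftedDressed_conjTranspose_eq_sum, shiftedDressed_eq_sum, matsubara_sum_left]
  rw [← Equiv.sum_comp FermionTorus.equivTorusSite.symm]
  refine Finset.sum_congr rfl fun x _ => ?_
  rw [matsubara_sum_right, ← Equiv.sum_comp FermionTorus.equivTorusSite.symm, Finset.mul_sum]
  simp only [FermionTorus.equivTorusSite, Equiv.coe_fn_symm_mk, FermionTorus.toTorusSite_ofTorusSite]

/-- **Per-pair decay for the dressed modes**: for `x ≠ y`, a fermionic `k` with `|k| ≥ π/β`: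
`‖∫₀^β e^{ikτ}⟨A_{x̂}(τ)A_{ŷ}†⟩‖ ≤ (9/4)(5β/π)·e^{−γ·dist(x,y)}`. -/
theorem norm_dressedPair_matsubara_le [instDE : DecidableEq (FermionTorus 2 L)] (U μ : ℝ) {β : ℝ} (hβ : 0 < β)
    {k : ℝ} (hk : cexp (I * k * β) = -1) (hka : Real.pi / β ≤ |k|) {x y : TorusSite 2 L} (hxy : x ≠ y) :
    ‖∫ τ in (0 : ℝ)..β, cexp (I * k * τ) * gibbsState β (hubbardTorusWith 2 L 1 U μ)
        (imagTimeEvolve (hubbardTorusWith 2 L 1 U μ) (τ : ℂ)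
          (annihilation (orb (FermionTorus.ofTorusSite x) 0) * numberOp (FermionTorus.ofTorusSite x) 1 -
            (1 / 2 : ℂ) • annihilation (orb (FermionTorus.ofTorusSite x) 0)) *
          (annihilation (orb (FermionTorus.ofTorusSite y) 0) * numberOp (FermionTorus.ofTorusSite y) 1 -
            (1 / 2 : ℂ) • annihilation (orb (FermionTorus.ofTorusSite y) 0))ᴴ)‖ ≤
      (3 / 2) * (3 / 2) * (5 * β / Real.pi) *
        Real.exp (-(min (1 / 2 : ℝ) (Real.pi / (8 * (Real.exp 1 * (2 * (2 * |(1 : ℝ)| + |U| + 2 * |μ|) * (2 * (2 * 4 + 1) : ℕ))) * β)) *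
          torusDist x y)) := by
  -- instance bookkeeping (see `norm_anticommutator_hubbardTorus_le`)
  obtain rfl : instDE = LinearOrder.toDecidableEq := Subsingleton.elim _ _
  letI instDE : DecidableEq (FermionTorus 2 L) := LinearOrder.toDecidableEq
  have hne : FermionTorus.ofTorusSite x ≠ FermionTorus.ofTorusSite y := fun h => hxy (by
    have := congrArg FermionTorus.toTorusSite h
    simpa using this)
  exact norm_matsubara_singleSite_le U μ hβ x y (dressedMode_mem _) (dressedMode_conjTranspose_mem _)
    (parityOp_mul_dressedMode _) (parityOp_mul_dressedMode_conjTranspose _) (by norm_num) (by norm_num)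
    (norm_dressedMode_le _) (norm_dressedMode_conjTranspose_le _) (dressedMode_anticomm_conjTranspose_eq_zero hne) hk hka

end DressedTorus



end Summit.HubbardSuperconductivity.HubbardSuperconductivity.Theorems.ThermalGreen

end
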